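import Summits.Ventures.PercRepro.RankLevelSetLevelSixT9Cell7
import Summits.Ventures.PercRepro.RankLevelSetLevelSixT9Cell8
import Summits.Ventures.PercRepro.RankLevelSetLevelSixT9Cell9
import Summits.Ventures.PercRepro.RankLevelSetLevelSixT9Cell10
import Summits.Ventures.PercRepro.RankLevelSetLevelSixT9Cell11
import Summits.Ventures.PercRepro.RankLevelSetLevelSixT9Cell12
import Summits.Ventures.PercRepro.RankLevelSetLevelSixT9Cell13
import Summits.Ventures.PercRepro.RankLevelSetLevelSixT9Cell14
import Summits.Ventures.PercRepro.RankLevelSetLevelSixT9Cell15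
import Summits.Ventures.PercRepro.RankLevelSetLevelSixT9Cell16
import Summits.Ventures.PercRepro.RankLevelSetLevelSixT9Cell17
import Summits.Ventures.PercRepro.RankLevelSetLevelSixT9Cell18
import Summits.Ventures.PercRepro.RankLevelSetLevelSixT9Cell19
import Summits.Ventures.PercRepro.RankLevelSetLevelSixT9Cell20
import Summits.Ventures.PercRepro.RankLevelSetLevelSixT9Cell21
import Summits.Ventures.PercRepro.RankLevelSetLevelSixT9Cell22
import Summits.Ventures.PercRepro.RankLevelSetLevelSixT9Cell23
import Summits.Ventures.PercRepro.RankLevelSetLevelSixT9Cell24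
import Summits.Ventures.PercRepro.RankLevelSetLevelSixT9Cell25
import Summits.Ventures.PercRepro.RankLevelSetLevelSixT9Cell26
import Summits.Ventures.PercRepro.RankLevelSetLevelSixT9Cell27
import Summits.Ventures.PercRepro.RankLevelSetLevelSixT9Cell28
import Summits.Ventures.PercRepro.RankLevelSetLevelSixT9Cell29
import Summits.Ventures.PercRepro.RankLevelSetLevelSixT9Cell30
import Summits.Ventures.PercRepro.RankLevelSetLevelSixT9Cell31
import Summits.Ventures.PercRepro.RankLevelSetLevelSixT9Cell32
import Summits.Ventures.PercRepro.RankLevelSetLevelSixT9Cell33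
import Summits.Ventures.PercRepro.S3MidKeyNine
import Summits.Ventures.PercRepro.S3SixWindow
import Summits.Ventures.PercRepro.RankLevelSetLevelFiveLadder

/-!
# PercRepro — THE 9 ROW'S CORE: `c025_core_six_nine (d ≥ 7) : RLS M 9 6` — EVERY `e`-FREE CORE OF RANK `9` AT LEVEL `6`, AND THE
ROW 9 GIVEN THE ROW 10 (p7 g22, S3 feeder; p8's assembly shape)

The core cells `(9, d)`: `7 ≤ d ≤ 33` by the coloop device with the lossy ladder (`c025_core_six_nine_<d>`: `k = 0` the LP cell
`(9, d)`, `k = 1` the LP cell `(8, d)` at `2/7`, `k ≥ 2` retired), `d ≥ 34` by the middle key (`S3Mid.c025_core_six_midkey_nine`,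
no coloop-freeness needed). Then the level-5 glue `rls_six_at_of_core 9` on `c025_five_all` (level `5` at `p = 8`) gives level `6` at
`p = 9`; with the 10 row (`c025_six_large_ten`, p8's) this is the 9 row: **`c025_six_large_nine_of_ten`**.
Axioms: standard.
-/

open scoped Matroid

namespace PercRepro

namespace ThmN

variable {α : Type}

/-- **The core cell `(9, d)` at every corank `d ≥ 7`, every `e`-free core.** -/
theorem c025_core_six_nine (M : Matroid α) [M.Finite] (d : ℕ) (hd7 : 7 ≤ d)
    (hR : M.eRank = (9 : ℕ∞)) (hn : M.E.ncard = 9 + d)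
    (hfree : ∀ e ∈ M.E, ∃ A ⊆ M.E \ {e}, e ∉ M.closure A ∧ e ∉ M.closure ((M.E \ {e}) \ A)) :
    RLS M 9 6 := by
  rcases Nat.lt_or_ge d 34 with hlt | hge
  · interval_cases d
    · exact c025_core_six_nine_7 M hR hn hfree
    · exact c025_core_six_nine_8 M hR hn hfree
    · exact c025_core_six_nine_9 M hR hn hfree
    · exact c025_core_six_nine_10 M hR hn hfree
    · exact c025_core_six_nine_11 M hR hn hfree
    · exact c025_core_six_nine_12 M hR hn hfree
    · exact c025_core_six_nine_13 M hR hn hfree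
    · exact c025_core_six_nine_14 M hR hn hfree
    · exact c025_core_six_nine_15 M hR hn hfree
    · exact c025_core_six_nine_16 M hR hn hfree
    · exact c025_core_six_nine_17 M hR hn hfree
    · exact c025_core_six_nine_18 M hR hn hfree
    · exact c025_core_six_nine_19 M hR hn hfree
    · exact c025_core_six_nine_20 M hR hn hfree
    · exact c025_core_six_nine_21 M hR hn hfree
    · exact c025_core_six_nine_22 M hR hn hfree
    · exact c025_core_six_nine_23 M hR hn hfree
    · exact c025_core_six_nine_24 M hR hn hfree
    · exact c025_core_six_nine_25 M hR hn hfree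
    · exact c025_core_six_nine_26 M hR hn hfree
    · exact c025_core_six_nine_27 M hR hn hfree
    · exact c025_core_six_nine_28 M hR hn hfree
    · exact c025_core_six_nine_29 M hR hn hfree
    · exact c025_core_six_nine_30 M hR hn hfree
    · exact c025_core_six_nine_31 M hR hn hfree
    · exact c025_core_six_nine_32 M hR hn hfree
    · exact c025_core_six_nine_33 M hR hn hfree
  · exact S3Mid.c025_core_six_midkey_nine M d hge hR hn hfree

/-- **THEOREM C₆ AT RANK `9`**: level `6` at `p = 9` for every finite matroid (on level `5` at `p = 8`, `c025_five_all`). -/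
theorem c025_six_at_nine (M : Matroid α) [M.Finite] : RLS M 9 6 :=
  rls_six_at_of_core 9 (by norm_num) (fun M _ => c025_five_all M 8 (by norm_num))
    (fun M _ d hd hR hn hfree => c025_core_six_nine M d hd hR hn hfree) M

/-- **THE 9 ROW GIVEN THE 10 ROW**: C-025 at level `6` for every `p ≥ 9`, every finite matroid, from the 10 row. -/
theorem c025_six_large_nine_of_ten (h10 : ∀ (M : Matroid α) [M.Finite] (p : ℕ), 10 ≤ p → RLS M p 6)
    (M : Matroid α) [M.Finite] (p : ℕ) (hp : 9 ≤ p) : RLS M p 6 := by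
  rcases Nat.lt_or_ge p 10 with hlt | hge
  · have hP : p = 9 := by omega
    subst hP
    exact c025_six_at_nine M
  · exact h10 M p hge

end ThmN

end PercRepro
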